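import Mathlib.Geometry.Manifold.PartitionOfUnity
import Mathlib.Geometry.Manifold.LocalDiffeomorph
import Mathlib.MeasureTheory.Measure.Haar.OfBasis
import Mathlib.MeasureTheory.Integral.Bochner.Set
import Mathlib.LinearAlgebra.Orientation
import Mathlib.Data.Real.Sign
import Summits.Ventures.HodgeRepro2.HostAPI.Carriers.Geometry.Kaehler.ManifoldForms
import Summits.Ventures.HodgeRepro2.HostAPI.Carriers.Geometry.Kaehler.RiemannianHodge
import Summits.Ventures.HodgeRepro2.HostAPI.Util.ForallBinderLint
open HostAPI.Carriers

noncomputable section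

open scoped Manifold ContDiff Topology
open Bundle Set Module MeasureTheory

namespace HostAPI.Carriers.NumberTheory.Transcendental

variable {E : Type*} [NormedAddCommGroup E] [NormedSpace ℝ E] [FiniteDimensional ℝ E]
  {n : ℕ} [Fact (finrank ℝ E = n)]
  {H : Type*} [TopologicalSpace H] {I : ModelWithCorners ℝ E H}
  {M : Type*} [TopologicalSpace M] [ChartedSpace H M]

section ChartLevel

variable (E n) in

def modelBasis : Basis (Fin n) ℝ E :=
  (finBasis ℝ E).reindex (finCongr Fact.out)

def chartSign (o : (x : M) → Orientation ℝ (TangentSpace I x) (Fin n)) (x₀ : M) (y : E) : ℝ :=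
  Real.sign ((o ((extChartAt I x₀).symm y)).someVector fun j ↦
    mfderivWithin 𝓘(ℝ, E) I (extChartAt I x₀).symm (range I) y (modelBasis E n j))

def IsContinuousOrientation (o : (x : M) → Orientation ℝ (TangentSpace I x) (Fin n)) : Prop :=
  ∀ x₀ : M, ∀ᶠ y in 𝓝[range I] (extChartAt I x₀ x₀),
    chartSign o x₀ y = chartSign o x₀ (extChartAt I x₀ x₀) ∧ chartSign o x₀ y ≠ 0

theorem chartSign_neg (o : (x : M) → Orientation ℝ (TangentSpace I x) (Fin n)) (x₀ : M)
    (y : E) : chartSign (fun x ↦ -o x) x₀ y = -chartSign o x₀ y := by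
  suffices h : ∀ (r : Orientation ℝ (TangentSpace I ((extChartAt I x₀).symm y)) (Fin n)) v,
      Real.sign ((-r).someVector v) = -Real.sign (r.someVector v) from h _ _
  intro r v
  have h0 : ∀ r : Orientation ℝ (TangentSpace I ((extChartAt I x₀).symm y)) (Fin n),
      r.someVector ≠ 0 := fun r ↦ Module.Ray.someVector_ne_zero r
  have hray : SameRay ℝ (-r).someVector (-r.someVector) := by
    rw [← ray_eq_iff (R := ℝ) (h0 _) (neg_ne_zero.2 (h0 r)), Module.Ray.someVector_ray,
      ← neg_rayOfNeZero (R := ℝ) _ (h0 r), Module.Ray.someVector_ray]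
  obtain ⟨c, hc, hcv⟩ := hray.exists_pos_right (h0 _) (neg_ne_zero.2 (h0 r))
  rw [hcv, AlternatingMap.smul_apply, AlternatingMap.neg_apply, smul_eq_mul, ← Real.sign_neg]
  generalize -(r.someVector v) = t
  rcases lt_trichotomy t 0 with ht | rfl | ht
  · rw [Real.sign_of_neg ht, Real.sign_of_neg (mul_neg_of_pos_of_neg hc ht)]
  · simp [Real.sign_zero]
  · rw [Real.sign_of_pos ht, Real.sign_of_pos (mul_pos hc ht)]

section PartitionOfUnity

variable [T2Space M] [SigmaCompactSpace M] [IsManifold I ∞ M]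

variable (I M) in

def chartPartitionOfUnity : SmoothPartitionOfUnity M I M univ :=
  Classical.choose (SmoothPartitionOfUnity.exists_isSubordinate_chartAt_source I M)

theorem chartPartitionOfUnity_isSubordinate :
    (chartPartitionOfUnity I M).IsSubordinate fun x ↦ (chartAt H x).source :=
  Classical.choose_spec (SmoothPartitionOfUnity.exists_isSubordinate_chartAt_source I M)

end PartitionOfUnity

variable [MeasurableSpace E] [BorelSpace E]

def _root_.HostAPI.Carriers.Geometry.Kaehler.MForm.integralPU {ι : Type*} {s : Set M} (ρ : SmoothPartitionOfUnity ι I M s)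
    (o : (x : M) → Orientation ℝ (TangentSpace I x) (Fin n)) (c : ι → M) (α : HostAPI.Carriers.Geometry.Kaehler.MForm I M ℝ n) :
    ℝ :=
  ∑ᶠ i, ∫ y in (extChartAt I (c i)).target,
    chartSign o (c i) y * ρ i ((extChartAt I (c i)).symm y) *
      α.inChart (c i) y (modelBasis E n) ∂(modelBasis E n).addHaar

end ChartLevel

section Integral

variable [MeasurableSpace E] [BorelSpace E] [T2Space M] [SigmaCompactSpace M] [IsManifold I ∞ M]

def _root_.HostAPI.Carriers.Geometry.Kaehler.MForm.integral (o : (x : M) → Orientation ℝ (TangentSpace I x) (Fin n)) (α : HostAPI.Carriers.Geometry.Kaehler.MForm I M ℝ n) :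
    ℝ :=
  α.integralPU (chartPartitionOfUnity I M) o id

variable (o : (x : M) → Orientation ℝ (TangentSpace I x) (Fin n))

section MForm
open HostAPI.Carriers.Geometry.Kaehler (MForm)
open HostAPI.Carriers.Geometry.Kaehler.MForm

def _root_.HostAPI.Carriers.Geometry.Kaehler.MForm.integralPU_eq_integral : Prop :=
  ∀ [CompactSpace M] {ι : Type*} (ρ : SmoothPartitionOfUnity ι I M univ) (c : ι → M),
    (ρ.IsSubordinate fun i ↦ (chartAt H (c i)).source) → IsContinuousOrientation o →
      ∀ {α : MForm I M ℝ n}, HostAPI.Carriers.Geometry.Kaehler.IsSmoothForm α → α.integralPU ρ o c = α.integral o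

def _root_.HostAPI.Carriers.Geometry.Kaehler.MForm.integral_add : Prop :=
  ∀ [CompactSpace M], IsContinuousOrientation o → ∀ {α β : MForm I M ℝ n},
    HostAPI.Carriers.Geometry.Kaehler.IsSmoothForm α → HostAPI.Carriers.Geometry.Kaehler.IsSmoothForm β → (α + β).integral o = α.integral o + β.integral o

theorem _root_.HostAPI.Carriers.Geometry.Kaehler.MForm.integral_smul (c : ℝ) (α : MForm I M ℝ n) : (c • α).integral o = c * α.integral o := by
  simp only [MForm.integral, MForm.integralPU, MForm.inChart_smul, Pi.smul_apply,
    ContinuousAlternatingMap.smul_apply, smul_eq_mul, mul_finsum, ← integral_const_mul]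
  congr 1 with i
  congr 1 with y
  ring

theorem _root_.HostAPI.Carriers.Geometry.Kaehler.MForm.integral_neg_orientation (α : MForm I M ℝ n) :
    α.integral (fun x ↦ -o x) = -α.integral o := by
  simp only [MForm.integral, MForm.integralPU, chartSign_neg, neg_mul, integral_neg,
    finsum_neg_distrib]

def _root_.HostAPI.Carriers.Geometry.Kaehler.MForm.integral_pullback : Prop :=
  ∀ {E' : Type*} [NormedAddCommGroup E'] [NormedSpace ℝ E'] [FiniteDimensional ℝ E'] [Fact (finrank ℝ E' = n)] [MeasurableSpace E'] [BorelSpace E'] {H' : Type*} [TopologicalSpace H'] {I' : ModelWithCorners ℝ E' H'} {N : Type*} [TopologicalSpace N] [ChartedSpace H' N] [T2Space N] [CompactSpace N] [IsManifold I' ∞ N] (o' : (x : N) → Orientation ℝ (TangentSpace I' x) (Fin n)), IsContinuousOrientation o' → ∀ (f : M ≃ₘ^(∞ : WithTop ℕ∞)⟮I, I'⟯ N), (∀ x, Orientation.map (Fin n) (f.mfderivToContinuousLinearEquiv (by simp) x).toLinearEquiv (o x) = o' (f x)) → ∀ {β : MForm I' N ℝ n}, HostAPI.Carriers.Geometry.Kaehler.IsSmoothForm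 β →
    MForm.integral o (fun x ↦ (β (f x)).compContinuousLinearMap (mfderiv I I' f x)) =
      β.integral o'

def _root_.HostAPI.Carriers.Geometry.Kaehler.MForm.integral_mextDeriv_eq_zero : Prop :=
  ∀ [CompactSpace M] [I.Boundaryless] {m : ℕ} (h : m + 1 = n), IsContinuousOrientation o →
    ∀ {β : MForm I M ℝ m}, HostAPI.Carriers.Geometry.Kaehler.IsSmoothForm β → MForm.integral o (h ▸ HostAPI.Carriers.Geometry.Kaehler.mextDeriv β) = 0

def _root_.HostAPI.Carriers.Geometry.Kaehler.MForm.integral_eq_zero_of_mem_exactSmoothForms : Prop :=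
  ∀ [CompactSpace M] [I.Boundaryless], IsContinuousOrientation o →
    ∀ {α : MForm I M ℝ n}, α ∈ HostAPI.Carriers.Geometry.Kaehler.exactSmoothForms I M ℝ n → α.integral o = 0

end MForm

section Bridge

variable [RiemannianBundle (fun x : M ↦ TangentSpace I x)]

def isContinuousOrientation_of_isSmoothForm_riemannianVolumeForm : Prop :=
  ∀ [IsContinuousRiemannianBundle E (fun x : M ↦ TangentSpace I x)],
    HostAPI.Carriers.Geometry.Kaehler.IsSmoothForm (HostAPI.Carriers.Geometry.Kaehler.riemannianVolumeForm o) → IsContinuousOrientation o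

def isSmoothForm_riemannianVolumeForm_of_isContinuousOrientation : Prop :=
  ∀ [IsContinuousRiemannianBundle E (fun x : M ↦ TangentSpace I x)]
    [IsContMDiffRiemannianBundle I ∞ E (fun x : M ↦ TangentSpace I x)],
    IsContinuousOrientation o → HostAPI.Carriers.Geometry.Kaehler.IsSmoothForm (HostAPI.Carriers.Geometry.Kaehler.riemannianVolumeForm o)

def integral_riemannianVolumeForm_pos : Prop :=
  ∀ [CompactSpace M] [Nonempty M] [IsContinuousRiemannianBundle E (fun x : M ↦ TangentSpace I x)],
    HostAPI.Carriers.Geometry.Kaehler.IsSmoothForm (HostAPI.Carriers.Geometry.Kaehler.riemannianVolumeForm o) → 0 < (HostAPI.Carriers.Geometry.Kaehler.riemannianVolumeForm o).integral o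

def integral_smul_riemannianVolumeForm_nonneg : Prop :=
  ∀ {f : M → ℝ}, (∀ x, 0 ≤ f x) → 0 ≤ HostAPI.Carriers.Geometry.Kaehler.MForm.integral o (fun x ↦ f x • HostAPI.Carriers.Geometry.Kaehler.riemannianVolumeForm o x)

end Bridge

section Closed

variable [CompactSpace M] [I.Boundaryless]

def _root_.HostAPI.Carriers.Geometry.Kaehler.deRhamCohomology.integral (ho : IsContinuousOrientation o) (hadd : HostAPI.Carriers.Geometry.Kaehler.MForm.integral_add o)
    (hex : HostAPI.Carriers.Geometry.Kaehler.MForm.integral_eq_zero_of_mem_exactSmoothForms o) :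
    HostAPI.Carriers.Geometry.Kaehler.deRhamCohomology I M ℝ n →ₗ[ℝ] ℝ :=
  Submodule.liftQ _
    { toFun := fun α ↦ HostAPI.Carriers.Geometry.Kaehler.MForm.integral o (α : HostAPI.Carriers.Geometry.Kaehler.MForm I M ℝ n)
      map_add' := fun α β ↦ hadd ho α.2.1 β.2.1
      map_smul' := fun c α ↦ HostAPI.Carriers.Geometry.Kaehler.MForm.integral_smul o c (α : HostAPI.Carriers.Geometry.Kaehler.MForm I M ℝ n) }
    fun α hα ↦ by
      simpa using hex ho (Submodule.mem_comap.1 hα)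

@[simp]
theorem _root_.HostAPI.Carriers.Geometry.Kaehler.deRhamCohomology.integral_mk (ho : IsContinuousOrientation o)
    (hadd : HostAPI.Carriers.Geometry.Kaehler.MForm.integral_add o) (hex : HostAPI.Carriers.Geometry.Kaehler.MForm.integral_eq_zero_of_mem_exactSmoothForms o)
    (α : HostAPI.Carriers.Geometry.Kaehler.closedSmoothForms I M ℝ n) :
    HostAPI.Carriers.Geometry.Kaehler.deRhamCohomology.integral o ho hadd hex (HostAPI.Carriers.Geometry.Kaehler.deRhamCohomology.mk α) =
      HostAPI.Carriers.Geometry.Kaehler.MForm.integral o (α : HostAPI.Carriers.Geometry.Kaehler.MForm I M ℝ n) :=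
  rfl

def _root_.HostAPI.Carriers.Geometry.Kaehler.deRhamCohomology.integral_bijective : Prop :=
  ∀ [ConnectedSpace M] [Nonempty M] (ho : IsContinuousOrientation o) (hadd : HostAPI.Carriers.Geometry.Kaehler.MForm.integral_add o)
    (hex : HostAPI.Carriers.Geometry.Kaehler.MForm.integral_eq_zero_of_mem_exactSmoothForms o),
    Function.Bijective (HostAPI.Carriers.Geometry.Kaehler.deRhamCohomology.integral o ho hadd hex)

end Closed

end Integral

end HostAPI.Carriers.NumberTheory.Transcendental
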